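import Literature.NumberTheory.CubicFields.ThreeTorsionParametrizationUniqueness
import HarnessLib

/-!
# The discriminant of the form attached to a geometric progression: `disc(a) · N(θ₀) = A³ s²` (HCL I, (22))

Topic `Literature/NumberTheory/CubicFields`, continuing `ThreeTorsionParametrizationUniqueness.lean`
(`A θ₁² + B θ₀θ₁ + C θ₀² = 0` for a progression `θ` with `π`-parts `a`). Eighth step of the
class-field-theory-free road to the Davenport–Heilbronn theorem on `Cl(K)[3]`
(Bhargava–Varma 2016, §§2–3): the input for the surjectivity half of HCL I Thm 13.

Bhargava, HCL I, proof of Thm 13: "First, the ring `S` is completely determined. To see this, we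
use the system of equations (21) to obtain the identity `Disc(C) = N(I)⁶N(δ)⁻² · Disc(S)` …
By assumption `N(δ) = N(I)³`, so (22) `Disc(C) = Disc(S)`." For a progression `θ₀, …, θ₃` in a
field `K ∋ s` with a ring endomorphism `σ`, `σ s = −s`, and integral `π`-parts
`θᵢ − σθᵢ = aᵢ s`, this file proves the field-level identities from which (22) follows once norms
are available (`N(θ₀) = θ₀ σθ₀`):

* `hess_A_mul_sq_mul_norm` — **`A s² · θ₀σθ₀ = (θ₀σθ₁ − σθ₀θ₁)²`** (so `A ≠ 0` for a nondegenerate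
  progression, `hess_A_ne_zero_of_nondeg`);
* `disc_mul_norm_theta₀` — **`disc(a) · θ₀σθ₀ = A³ s²`**: from `(2Aθ₁ + Bθ₀)² = disc(a) θ₀²`
  (the Hessian relation), its conjugate, and nondegeneracy (which forces
  `θ₀ · σ(2Aθ₁ + Bθ₀) = −σθ₀ · (2Aθ₁ + Bθ₀)`).

Consequently `disc(a) = s² = D` exactly when `N(θ₀) = A³`, which the surjectivity file derives
from `N(δ) = ±N(I)³` (i.e. `I³ = (δ)`). All statements are proved.

## References

* M. Bhargava, *Higher composition laws I*, Ann. of Math. 159 (2004), §3.4, proof of Thm 13,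
  eq. (22) [Bhargava2004HCL1].
-/

namespace Literature.NumberTheory.CubicFields

namespace SymCubic

variable {K : Type*} [Field K] [CharZero K]

section

variable (a : SymCubic ℤ) (σ : K →+* K) {s : K}
  {θ₀ θ₁ θ₂ θ₃ : K} (h02 : θ₀ * θ₂ = θ₁ ^ 2) (h13 : θ₁ * θ₃ = θ₂ ^ 2) (h03 : θ₀ * θ₃ = θ₁ * θ₂)
  (hπ₀ : θ₀ - σ θ₀ = (a.a₀ : K) * s) (hπ₁ : θ₁ - σ θ₁ = (a.a₁ : K) * s)
  (hπ₂ : θ₂ - σ θ₂ = (a.a₂ : K) * s) (hπ₃ : θ₃ - σ θ₃ = (a.a₃ : K) * s)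
include h02 h13 h03 hπ₀ hπ₁ hπ₂ hπ₃

omit [CharZero K] h13 h03 hπ₃ in
/-- **`A s² · θ₀σθ₀ = (θ₀σθ₁ − σθ₀θ₁)²`** (`A = a₁² − a₀a₂`; classically `A = N(θ₀)(λ − λ̄)²/D` for
the ratio `λ = θ₁/θ₀`). [folklore] -/
theorem hess_A_mul_sq_mul_norm :
    (a.hess.1 : K) * s ^ 2 * (θ₀ * σ θ₀) = (θ₀ * σ θ₁ - σ θ₀ * θ₁) ^ 2 := by
  have hA := hess_A_mul_sq a σ hπ₀ hπ₁ hπ₂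
  have s02 : σ θ₀ * σ θ₂ = σ θ₁ ^ 2 := by rw [← map_mul, ← map_pow, h02]
  linear_combination (θ₀ * σ θ₀) * hA - ((θ₀ - σ θ₀) * σ θ₀) * h02 + ((θ₀ - σ θ₀) * θ₀) * s02

omit [CharZero K] h13 h03 hπ₃ in
/-- For a nondegenerate progression (`θ₀σθ₁ ≠ σθ₀θ₁`): `A ≠ 0` and `θ₀σθ₀ ≠ 0`. [folklore] -/
theorem hess_A_ne_zero_of_nondeg (hnd : θ₀ * σ θ₁ ≠ σ θ₀ * θ₁) :
    (a.hess.1 : K) ≠ 0 ∧ θ₀ * σ θ₀ ≠ 0 := by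
  have h := hess_A_mul_sq_mul_norm a σ h02 hπ₀ hπ₁ hπ₂
  have hne : (θ₀ * σ θ₁ - σ θ₀ * θ₁) ^ 2 ≠ 0 := pow_ne_zero 2 (sub_ne_zero.mpr hnd)
  rw [← h] at hne
  exact ⟨fun h0 => hne (by rw [h0]; ring), fun h0 => hne (by rw [h0]; ring)⟩

/-- **`disc(a) · θ₀σθ₀ = A³ s²`** for a nondegenerate progression with integral `π`-parts `a`
(HCL I (22) before inserting the norms: `Disc(C) · N(I)⁻⁶N(δ)² = Disc(S)` in the form
`disc(a) N(θ₀) = A³ D`). [cite: Bhargava2004HCL1, §3.4 (proof of Theorem 13, eq. (22))] -/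
theorem disc_mul_norm_theta₀ (hs0 : s ≠ 0) (hnd : θ₀ * σ θ₁ ≠ σ θ₀ * θ₁) :
    (a.disc : K) * (θ₀ * σ θ₀) = (a.hess.1 : K) ^ 3 * s ^ 2 := by
  obtain ⟨hA0, hN0⟩ := hess_A_ne_zero_of_nondeg a σ h02 hπ₀ hπ₁ hπ₂ hnd
  have hK1 := hess_A_mul_sq_mul_norm a σ h02 hπ₀ hπ₁ hπ₂
  -- the Hessian relation and `W = 2Aθ₁ + Bθ₀`, `W² = disc(a) θ₀²`
  have hq := sq_mul_hess_quadratic_eq_zero a σ h02 h13 h03 hπ₀ hπ₁ hπ₂ hπ₃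
  have hq' : (a.hess.1 : K) * θ₁ ^ 2 + (a.hess.2.1 : K) * (θ₀ * θ₁) + (a.hess.2.2 : K) * θ₀ ^ 2 = 0 := by
    rcases mul_eq_zero.mp hq with h | h
    · exact absurd h (pow_ne_zero 2 hs0)
    · exact h
  have hdisc : ((a.hess.2.1 : K) ^ 2 - 4 * (a.hess.1 : K) * (a.hess.2.2 : K)) = (a.disc : K) := by
    rw [← discr_hess a]; push_cast; ring
  set W := 2 * (a.hess.1 : K) * θ₁ + (a.hess.2.1 : K) * θ₀ with hW
  have hW2 : W ^ 2 = (a.disc : K) * θ₀ ^ 2 := by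
    rw [← hdisc]; linear_combination (4 * (a.hess.1 : K)) * hq'
  have hσW2 : σ W ^ 2 = (a.disc : K) * σ θ₀ ^ 2 := by
    have := congrArg σ hW2
    simp only [map_pow, map_mul, map_intCast] at this
    exact this
  -- `θ₀ σW − σθ₀ W = 2A (θ₀σθ₁ − σθ₀θ₁)`
  have hlin : θ₀ * σ W - σ θ₀ * W = 2 * (a.hess.1 : K) * (θ₀ * σ θ₁ - σ θ₀ * θ₁) := by
    simp only [hW, map_add, map_mul, map_ofNat, map_intCast]
    ring
  -- `(θ₀ σW)² = (σθ₀ W)²`, and the `+` sign is excluded by nondegeneracy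
  have hsq : (θ₀ * σ W - σ θ₀ * W) * (θ₀ * σ W + σ θ₀ * W) = 0 := by
    linear_combination θ₀ ^ 2 * hσW2 - σ θ₀ ^ 2 * hW2
  rcases mul_eq_zero.mp hsq with h | h
  · exfalso
    rw [hlin] at h
    rcases mul_eq_zero.mp h with h' | h'
    · exact (mul_ne_zero two_ne_zero hA0) h'
    · exact hnd (sub_eq_zero.mp h')
  · -- `θ₀ σW = −σθ₀ W`, so `A (θ₀σθ₁ − σθ₀θ₁) = θ₀ σW`, square and use `K1`
    have hθσW : (a.hess.1 : K) * (θ₀ * σ θ₁ - σ θ₀ * θ₁) = θ₀ * σ W := by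
      linear_combination (-(1 / 2 : K)) * h - (1 / 2 : K) * hlin
    have key : (a.hess.1 : K) ^ 2 * ((a.hess.1 : K) * s ^ 2 * (θ₀ * σ θ₀))
        = (a.disc : K) * (θ₀ * σ θ₀) * (θ₀ * σ θ₀) := by
      rw [hK1]
      linear_combination (θ₀ * σ W + (a.hess.1 : K) * (θ₀ * σ θ₁ - σ θ₀ * θ₁)) * hθσW
        + θ₀ ^ 2 * hσW2
    have : (θ₀ * σ θ₀) * ((a.disc : K) * (θ₀ * σ θ₀) - (a.hess.1 : K) ^ 3 * s ^ 2) = 0 := by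
      linear_combination -key
    rcases mul_eq_zero.mp this with h' | h'
    · exact absurd h' hN0
    · exact sub_eq_zero.mp h'

end

end SymCubic

end Literature.NumberTheory.CubicFields
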